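import Summits.CriticalPhenomena.PercolationContinuityZ3.Theorems.Transplant.PlanarSkeletonConcDefs
import Mathlib.Tactic.FinCases
import HarnessLib

/-!
# The ORDER-FOUR OBSTRUCTION for the node of record: a `PlanarSkeletonConc` forces an automorphism fixing the base vertex whose order is
# infinite or divisible by `4` — the criterion that separates the cubic-system lattices (ℤ³, fcc, bcc, diamond, `D₄`-invariant `Cay(ℤ³;S)`)
# from the hexagonal-system ones (`𝕋 □ ℤ`, hcp, kagome □ ℤ) in class C1b

builds on p205010 (kernel theorem, internal audit signed; external expert review pending) — nothing in this file uses p205010.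
Status sentence (coordinator 2026-08-20T04:30Z): "θ(p_c) = 0 on ℤ^d, all d ≥ 2 — kernel-verified (Lean 4/Mathlib,
standard axioms); internal adversarial audit SIGNED 2026-08-20 04:29Z; external expert review pending."

Lane `prim-bschramm-*`, seat `prim-bschramm-p2` (gen 6; `P2-LATTICES.md` §14 (1)).  The interface `PlanarSkeletonConc G` (SHEAR-SCOPE §3.3) asks, at
each base vertex `t`, for a lift of EVERY `g ∈ HOct 2 = D₄` to an automorphism fixing `t` and acting on the relative skeleton coordinate by `g`, and for
an outward unit step in every skeleton direction.  Consequence (this file, `φ`-INDEPENDENT): the lift `α` of the quarter-turn `(a,b) ↦ (−b,a)`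
satisfies `φ(αⁿ w) − φ t = rotⁿ(φ w − φ t)`; applied to the neighbour `t + e₀` of (ι), `αⁿ = id` forces `rotⁿ e₀ = e₀`, i.e. `4 ∣ n`
(`four_dvd_of_iterate_eq_id`).  Hence **no graph whose vertex stabilisers consist of automorphisms of finite order prime to `4` — more generally of
order not divisible by `4` — carries ANY `PlanarSkeletonConc`** (`not_planarSkeletonConc_of_stabiliser`): the formal reason why the stacked
triangular lattice (stabiliser `D₆ × C₂`, element orders `1,2,3,6`), hcp (`D_{3h}`) and kagome □ ℤ are out of reach of the node of record for every
choice of skeleton, while diamond (`T_d ∋ S₄`) is in reach (`DiamondSkeletonConc.lean`).  (Instance-level negatives for specific skeletons are p4-g7's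
`TriangularZNeg`, `Z3DiagonalNeg`, `DecoratedSlabNeg`.)
[cite: KozmaNitzan2024, §4 p. 15–16 (Lemma 8: the role of the lattice symmetries)] [cite: BenjaminiSchramm1996, Conj. 4]
-/

noncomputable section

namespace Summit.CriticalPhenomena.PercolationContinuityZ3.Theorems.Transplant

open Literature.Probability.Percolation Literature.Probability.LatticeModels SimpleGraph
open Literature.Probability.Percolation.GM (HOct sp)

/-! ## §1 The quarter-turn in `HOct 2` and its orbit on `e₀` -/

/-- The quarter-turn `(a, b) ↦ (−b, a)` as an element of `HOct 2` (swap the axes, negate the new first coordinate). [folklore] -/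
def quarterTurn : HOct 2 := (Equiv.swap 0 1, fun i => if i = 0 then -1 else 1)

/-- The quarter-turn acts by `(a, b) ↦ (−b, a)`. [folklore] -/
theorem sp_quarterTurn (x : Site 2) : sp quarterTurn x = ![-x 1, x 0] := by
  ext i
  rw [show sp quarterTurn x i = ((quarterTurn.2 i : ℤˣ) : ℤ) * x (quarterTurn.1.symm i) from Site.signedPerm_apply _ _ _ _]
  rcases (show i = 0 ∨ i = 1 by fin_cases i <;> simp) with rfl | rfl
  · simp [quarterTurn, Equiv.swap_apply_left]
  · simp [quarterTurn, Equiv.swap_apply_right]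

/-- Four quarter-turns are the identity. [folklore] -/
theorem sp_quarterTurn_iterate_four (x : Site 2) : (sp quarterTurn)^[4] x = x := by
  simp only [Function.iterate_succ, Function.iterate_zero, Function.comp_apply, id_eq, sp_quarterTurn]
  ext i
  rcases (show i = 0 ∨ i = 1 by fin_cases i <;> simp) with rfl | rfl <;> simp

/-- The orbit of `e₀` under the quarter-turn returns to `e₀` only at multiples of `4`. [folklore] -/
theorem four_dvd_of_iterate_quarterTurn_single {n : ℕ} (h : (sp quarterTurn)^[n] (Pi.single 0 1 : Site 2) = Pi.single 0 1) : 4 ∣ n := by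
  -- reduce to `n % 4`
  have hper : ∀ q (x : Site 2), (sp quarterTurn)^[4 * q] x = x := by
    intro q x
    induction q with
    | zero => simp
    | succ q ih =>
      rw [show 4 * (q + 1) = 4 * q + 4 by ring, Function.iterate_add_apply, sp_quarterTurn_iterate_four, ih]
  have hn : n = n % 4 + 4 * (n / 4) := by omega
  rw [hn, Function.iterate_add_apply, hper] at h
  -- the four residues: the orbit `e₀ ↦ e₁ ↦ −e₀ ↦ −e₁`
  have e1 : (sp quarterTurn)^[1] (Pi.single 0 1 : Site 2) = ![0, 1] := by
    simp only [Function.iterate_succ, Function.iterate_zero, Function.comp_apply, id_eq, sp_quarterTurn]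
    ext i; rcases (show i = 0 ∨ i = 1 by fin_cases i <;> simp) with rfl | rfl <;> simp
  have e2 : (sp quarterTurn)^[2] (Pi.single 0 1 : Site 2) = ![-1, 0] := by
    simp only [Function.iterate_succ, Function.iterate_zero, Function.comp_apply, id_eq, sp_quarterTurn]
    ext i; rcases (show i = 0 ∨ i = 1 by fin_cases i <;> simp) with rfl | rfl <;> simp
  have e3 : (sp quarterTurn)^[3] (Pi.single 0 1 : Site 2) = ![0, -1] := by
    simp only [Function.iterate_succ, Function.iterate_zero, Function.comp_apply, id_eq, sp_quarterTurn]
    ext i; rcases (show i = 0 ∨ i = 1 by fin_cases i <;> simp) with rfl | rfl <;> simp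
  have h1 : (sp quarterTurn)^[1] (Pi.single 0 1 : Site 2) ≠ Pi.single 0 1 := by
    rw [e1]; intro e; have := congrFun e 0; simp at this
  have h2 : (sp quarterTurn)^[2] (Pi.single 0 1 : Site 2) ≠ Pi.single 0 1 := by
    rw [e2]; intro e; have := congrFun e 0; simp at this
  have h3 : (sp quarterTurn)^[3] (Pi.single 0 1 : Site 2) ≠ Pi.single 0 1 := by
    rw [e3]; intro e; have := congrFun e 0; simp at this
  have hlt : n % 4 < 4 := Nat.mod_lt _ (by norm_num)
  interval_cases hm : n % 4
  · exact Nat.dvd_of_mod_eq_zero hm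
  · exact absurd h h1
  · exact absurd h h2
  · exact absurd h h3

/-! ## §2 Iterating a point-group lift -/

namespace PlanarSkeletonConc

variable {V : Type} {G : SimpleGraph V} [G.LocallyFinite] (Φ : PlanarSkeletonConc G)

/-- **Iterates of a lift act by iterates of `g`** on the relative skeleton coordinate. [folklore] -/
theorem phi_iterate_sub (t : V) (g : HOct 2) (α : G ≃g G) (hα : ∀ w, Φ.φ (α w) - Φ.φ t = sp g (Φ.φ w - Φ.φ t)) (n : ℕ) (w : V) :
    Φ.φ (α^[n] w) - Φ.φ t = (sp g)^[n] (Φ.φ w - Φ.φ t) := by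
  induction n generalizing w with
  | zero => simp
  | succ n ih => rw [Function.iterate_succ_apply, Function.iterate_succ_apply, ih (α w), hα w]

/-- **THE ORDER-FOUR OBSTRUCTION**: if a lift `α` of the quarter-turn at a base vertex `t` satisfies `αⁿ = id`, then `4 ∣ n` (test the outward
step `t → t + e₀` of (ι)). [cite: KozmaNitzan2024, §4 Lemma 8 p. 16] -/
theorem four_dvd_of_iterate_eq_id (t : V) (α : G ≃g G) (hα : ∀ w, Φ.φ (α w) - Φ.φ t = sp quarterTurn (Φ.φ w - Φ.φ t))
    {n : ℕ} (hn : ∀ w, α^[n] w = w) : 4 ∣ n := by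
  obtain ⟨v', -, hv'⟩ := Φ.step t 0 1
  have h := Φ.phi_iterate_sub t quarterTurn α hα n v'
  rw [hn v', hv', Units.val_one, add_sub_cancel_left] at h
  exact four_dvd_of_iterate_quarterTurn_single h.symm

/-- The lift of the quarter-turn exists at every base vertex (field `point`). [folklore] -/
theorem exists_point_quarterTurn {t : V} (ht : t ∈ Φ.types) :
    ∃ α : G ≃g G, α t = t ∧ ∀ w, Φ.φ (α w) - Φ.φ t = sp quarterTurn (Φ.φ w - Φ.φ t) :=
  Φ.point t ht quarterTurn

end PlanarSkeletonConc

/-! ## §3 The negative criterion -/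

/-- **NO `PlanarSkeletonConc` on a graph whose vertex stabilisers have no element of order divisible by four**: if every automorphism fixing
some vertex has a finite period not divisible by `4`, the graph carries no `PlanarSkeletonConc` with that vertex as a base vertex; if this
holds at EVERY vertex, it carries none at all (base vertices exist as soon as the graph is non-empty, by `frame`).  For the stacked triangular
lattice, hcp and kagome □ ℤ the stabilisers have element orders in `{1,2,3,6}`. [cite: KozmaNitzan2024, §4 Lemma 8 p. 16] -/
theorem not_planarSkeletonConc_of_stabiliser {V : Type} {G : SimpleGraph V} [G.LocallyFinite] [Nonempty V]
    (h : ∀ (t : V) (α : G ≃g G), α t = t → ∃ n : ℕ, 0 < n ∧ ¬ 4 ∣ n ∧ ∀ w, α^[n] w = w) (Φ : PlanarSkeletonConc G) : False := by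
  obtain ⟨v⟩ := ‹Nonempty V›
  obtain ⟨t, ht, -⟩ := Φ.frame v
  obtain ⟨α, hαt, hα⟩ := Φ.exists_point_quarterTurn ht
  obtain ⟨n, -, hn4, hn⟩ := h t α hαt
  exact hn4 (Φ.four_dvd_of_iterate_eq_id t α hα hn)

/-- Pointed form: no `PlanarSkeletonConc` has `t` among its base vertices if the stabiliser of `t` has no element of order divisible by `4`.
[cite: KozmaNitzan2024, §4 Lemma 8 p. 16] -/
theorem not_mem_types_of_stabiliser {V : Type} {G : SimpleGraph V} [G.LocallyFinite] (Φ : PlanarSkeletonConc G) {t : V}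
    (h : ∀ α : G ≃g G, α t = t → ∃ n : ℕ, 0 < n ∧ ¬ 4 ∣ n ∧ ∀ w, α^[n] w = w) : t ∉ Φ.types := by
  intro ht
  obtain ⟨α, hαt, hα⟩ := Φ.exists_point_quarterTurn ht
  obtain ⟨n, -, hn4, hn⟩ := h α hαt
  exact hn4 (Φ.four_dvd_of_iterate_eq_id t α hα hn)

end Summit.CriticalPhenomena.PercolationContinuityZ3.Theorems.Transplant

end
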